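import Literature.MathematicalPhysics.QuantumLattice.SpinSectorPartitionFnBandwidthTransfer
import HarnessLib

/-!
# The thermal pressure of the 2D `t–t'` Hubbard model minus the lattice-gas entropy is `βκ`-Lipschitz in the density

Topic `MathematicalPhysics/QuantumLattice` (family `hubbard`); sequel of `SpinSectorPartitionFnBandwidthTransfer.lean`
(the volume-free one-electron transfer: on the torus every added electron pair changes
`log Z − 2 log C(|Λ|, k)` by an amount in `[−2βκ₊, 2βκ₋]`, `κ₊ = 4|t| + 4|t'| + U⁺`, `κ₋ = 4|t| + 4|t'| + U⁻`) and the
SHARP form of `HubbardTTPrimeThermalPressureDensity.lean` §1–§2 (whose modulus carried the volume/holes factor and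
the full commutator norm, `2βr/(2−y)` with `r = 18(2|t|+|U|) + 36|t'|`). For the thermodynamic-limit pressure number
`p(β; t,t',U; n) = pressureTT' β t t' U n` (`U ≥ 0`, `β ≥ 0`, densities in `[0, 2)`):

* §1 finite volume (`L × L` torus, `k_L(n) = ⌊nL²/2⌋`): the INTERACTION FREE ENTROPY `p_L(β; n) − p_L(0; n)`
  (`p_L(0; n) = L⁻² log #sector = 2 L⁻² log C(L², k_L(n))`) changes between densities `x ≤ y` by an amount in
  `[−2βκ₊ (k_L(y) − k_L(x))/L², 2βκ₋ (k_L(y) − k_L(x))/L²]` (`sectorPressureTT'_interaction_sub_mem_local`);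
* §2 **`n ↦ p(β; n) − 2 H_b(n/2)` is Lipschitz with one-sided constants `βκ₊ = β(4|t| + 4|t'| + U)` (downwards) and
  `βκ₋ = β(4|t| + 4|t'|)` (upwards)**:
  `−β(4|t|+4|t'|+U)(y − x) ≤ [p(y) − 2H_b(y/2)] − [p(x) − 2H_b(x/2)] ≤ β(4|t|+4|t'|)(y − x)` for `0 ≤ x ≤ y < 2`
  (`pressureTT'_sub_binEntropy_sub_ge_local`, `…_le_local`, `abs_…_le_local`, `lipschitzOnWith_pressureTT'_sub_binEntropy`)
  — `2H_b(n/2) = p(0; n)` is the ideal lattice-gas entropy of the two spin species (`pressureTT'_zero`); at `β = 0`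
  the statement is an identity;
* §3 **sharp density slopes** (the chords of the binary entropy lie between its endpoint derivatives
  `log((2−n)/n)`): for `0 < x < y < 2`,
  `log((2−y)/y) − β(4|t|+4|t'|+U) ≤ (p(y) − p(x))/(y − x) ≤ log((2−x)/x) + β(4|t|+4|t'|)`
  (`density_mul_le_pressureTT'_sub_local`, `pressureTT'_sub_le_density_mul_local`, `pressureTT'_slope_mem_Icc_local`),
  and the Lipschitz modulus `max(|log((2−lo)/lo)|, |log((2−hi)/hi)|) + β(4|t|+4|t'|+U)` on `[lo, hi] ⊂ (0,2)`
  (`abs_pressureTT'_sub_le_density_local`, `lipschitzOnWith_pressureTT'_density_local`).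

READING (chemical potential at `T > 0`). In the grand-canonical Legendre picture `βμ = −∂p/∂n`, so §3 says: the
chemical potential of the density-`n` state lies in the band
`β⁻¹ log(n/(2−n)) − (4|t|+4|t'|) ≤ μ ≤ β⁻¹ log(n/(2−n)) + 4|t| + 4|t'| + U` — the ideal lattice-gas value plus a
one-particle energy in `[−(4|t|+4|t'|), 4|t|+4|t'|+U]` (bottom of the band … top of the band plus the Hubbard
repulsion), uniformly in `β` — the `T > 0` twin of the `T = 0` band-edge brackets. For the Hubbard programme S2
(density leg of the `(U, t', n) × T` box words, `n = 0.875 ± 0.01` at `β = 4`, `U = 8`, `t' = −1/4`, `t = 1`): the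
modulus is `≈ 0.25 + 4·13 = 52.3` per unit density (`±0.01` in `n` costs `≤ 0.53` in `p`, i.e. `≤ 0.13 t` in the free
energy per site), against `≈ 3·10³` from `abs_pressureTT'_sub_le_density`.

Everything is PROVED; no definition, no named fact. (Ruelle 1969 §3.4.7: the canonical free energy per site of a
lattice system is Lipschitz in the density, with the one-particle energy bound as constant.)

## Mathlib / tree search

REUSED: `log_partitionFn_sub_log_choose_pairs_mem_local` (`SpinSectorPartitionFnBandwidthTransfer`),
`tendsto_sectorPressureTT'`, `pressureTT'_zero`, `log_partitionFn_sectorHamiltonianTT'_eq_rect`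
(`HubbardTTPrimeThermalPressureLimit`), `sectorPressureTT'_zero` (`HubbardTTPrimeThermalPressure`),
`sectorGibbsCount_eq_choose_sq` (`TorusSectorPressureZeroAnchor`), `halfRectN_le_mul_self`, `tendsto_rectN_div_sq`;
Mathlib `Real.strictConcave_binEntropy`, `Real.hasDerivAt_binEntropy`, `ConcaveOn.slope_le_of_hasDerivAt`,
`ConcaveOn.le_slope_of_hasDerivAt`, `slope_def_field`, `LipschitzOnWith.of_dist_le'`, `le_of_tendsto_of_tendsto`.
`lean search 'binEntropy.*pressureTT|pressureTT.*binEntropy.*sub'`: only `pressureTT'_zero` / the a-priori ceiling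
(2026-08-27).

## References

* D. Ruelle, *Statistical Mechanics: Rigorous Results* (1969), §3.4. [cite: Ruelle1969, §3.4]
* R. B. Israel, *Convexity in the Theory of Lattice Gases* (1979), Thm. I.2.4. [cite: Israel1979, Thm. I.2.4]
-/

noncomputable section

namespace Literature.MathematicalPhysics.QuantumLattice

open Matrix Finset HubbardWave0 Literature.Probability.LatticeModels LiebThm1
open _root_.Filter
open scoped _root_.Topology ComplexOrder BigOperators

namespace ThermodynamicLimit

/-! ### §0 Floor bookkeeping for `k_L(n) = ⌊nL²/2⌋` -/

/-- `k_L` is monotone in the density. [folklore] -/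
private theorem halfRectN_mono' {x y : ℝ} (hxy : x ≤ y) (L : ℕ) : halfRectN x L ≤ halfRectN y L := by
  unfold halfRectN
  exact Nat.floor_le_floor (by nlinarith [sq_nonneg (L : ℝ)])

/-- `k_L(n)/L² → n/2`. [folklore] -/
private theorem tendsto_halfRectN_div_sq'' {n : ℝ} (hn0 : 0 ≤ n) :
    Tendsto (fun L : ℕ => (halfRectN n L : ℝ) / (L : ℝ) ^ 2) atTop (𝓝 (n / 2)) := by
  have h := (tendsto_rectN_div_sq hn0).div_const 2
  refine h.congr fun L => ?_
  have e : rectN n L = 2 * halfRectN n L := rfl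
  rw [e]
  push_cast
  ring

/-- At `β = 0`: `p_L(0; n) · L² = 2 log C(L², k_L(n))` (`#sector = C(L², k_L)²`). [cite: Israel1979, Lemma II.3.1] -/
theorem sectorPressureTT'_zero_mul_sq (t t' U n : ℝ) {L : ℕ} (hL : 1 ≤ L) :
    sectorPressureTT' 0 t t' U n L * (L : ℝ) ^ 2 = 2 * Real.log ((L * L).choose (halfRectN n L)) := by
  have hL2 : (0 : ℝ) < (L : ℝ) ^ 2 := by
    have : (1 : ℝ) ≤ L := by exact_mod_cast hL
    positivity
  rw [sectorPressureTT'_zero, div_mul_cancel₀ _ hL2.ne', sectorGibbsCount_eq_choose_sq, sq L, Nat.cast_pow,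
    Real.log_pow]
  push_cast
  ring

/-! ### §1 Finite volume: the interaction free entropy between two densities -/

section Finite

variable (t t' U : ℝ) {β : ℝ} (hβ : 0 ≤ β)
include hβ

/-- **The interaction free entropy at finite volume.** On the `L × L` torus (`L ≥ 1`), for densities
`0 ≤ x ≤ y < 2` and `k_L = ⌊·L²/2⌋`:
`−2βκ₊ (k_L(y) − k_L(x))/L² ≤ [p_L(β; y) − p_L(0; y)] − [p_L(β; x) − p_L(0; x)] ≤ 2βκ₋ (k_L(y) − k_L(x))/L²`,
`κ₊ = 4|t| + 4|t'| + max(U,0)`, `κ₋ = 4|t| + 4|t'| + max(−U,0)`. [cite: Ruelle1969, §3.4] -/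
theorem sectorPressureTT'_interaction_sub_mem_local {x y : ℝ} (hx0 : 0 ≤ x) (hxy : x ≤ y) (hy2 : y < 2) {L : ℕ}
    (hL : 1 ≤ L) :
    -(2 * (β * (4 * |t| + 4 * |t'| + max U 0)) * (((halfRectN y L : ℝ) - halfRectN x L) / (L : ℝ) ^ 2)) ≤
        (sectorPressureTT' β t t' U y L - sectorPressureTT' 0 t t' U y L) -
          (sectorPressureTT' β t t' U x L - sectorPressureTT' 0 t t' U x L) ∧
      (sectorPressureTT' β t t' U y L - sectorPressureTT' 0 t t' U y L) -
          (sectorPressureTT' β t t' U x L - sectorPressureTT' 0 t t' U x L) ≤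
        2 * (β * (4 * |t| + 4 * |t'| + max (-U) 0)) * (((halfRectN y L : ℝ) - halfRectN x L) / (L : ℝ) ^ 2) := by
  have hL2 : (0 : ℝ) < (L : ℝ) ^ 2 := by
    have : (1 : ℝ) ≤ L := by exact_mod_cast hL
    positivity
  have hk : halfRectN x L ≤ halfRectN y L := halfRectN_mono' hxy L
  obtain ⟨d, hd⟩ : ∃ d, halfRectN y L = halfRectN x L + d := ⟨_, (Nat.add_sub_cancel' hk).symm⟩
  have htop : halfRectN x L + d ≤ L * L := by
    rw [← hd]; exact (halfRectN_lt_sq (hx0.trans hxy) hy2 hL).le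
  obtain ⟨h₁, h₂⟩ := log_partitionFn_sub_log_choose_pairs_mem_local L L t t' U hβ d (halfRectN x L) htop
  rw [← hd] at h₁ h₂
  have hdR : (d : ℝ) = (halfRectN y L : ℝ) - halfRectN x L := by rw [hd]; push_cast; ring
  rw [hdR] at h₁ h₂
  -- the four pressures times `L²`
  have eβ : ∀ n : ℝ, sectorPressureTT' β t t' U n L =
      Real.log (partitionFn β (spinSectorHamiltonian (halfRectN n L) (halfRectN n L)
        (hubbardRectTorusTT' L L t t' U))).re / (L : ℝ) ^ 2 := fun n => by
    rw [sectorPressureTT', log_partitionFn_sectorHamiltonianTT'_eq_rect]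
  have e0 : ∀ n : ℝ, sectorPressureTT' 0 t t' U n L = 2 * Real.log ((L * L).choose (halfRectN n L)) / (L : ℝ) ^ 2 :=
    fun n => by rw [← sectorPressureTT'_zero_mul_sq t t' U n hL, mul_div_cancel_right₀ _ hL2.ne']
  have key : (sectorPressureTT' β t t' U y L - sectorPressureTT' 0 t t' U y L) -
      (sectorPressureTT' β t t' U x L - sectorPressureTT' 0 t t' U x L) =
      ((Real.log (partitionFn β (spinSectorHamiltonian (halfRectN y L) (halfRectN y L)
          (hubbardRectTorusTT' L L t t' U))).re - 2 * Real.log ((L * L).choose (halfRectN y L))) -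
        (Real.log (partitionFn β (spinSectorHamiltonian (halfRectN x L) (halfRectN x L)
          (hubbardRectTorusTT' L L t t' U))).re - 2 * Real.log ((L * L).choose (halfRectN x L)))) /
        (L : ℝ) ^ 2 := by
    rw [eβ, eβ, e0, e0]
    field_simp
  rw [key]
  constructor
  · rw [show -(2 * (β * (4 * |t| + 4 * |t'| + max U 0)) * (((halfRectN y L : ℝ) - halfRectN x L) / (L : ℝ) ^ 2)) =
        -(2 * (β * (4 * |t| + 4 * |t'| + max U 0)) * ((halfRectN y L : ℝ) - halfRectN x L)) / (L : ℝ) ^ 2 by ring]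
    exact div_le_div_of_nonneg_right h₁ hL2.le
  · rw [show 2 * (β * (4 * |t| + 4 * |t'| + max (-U) 0)) * (((halfRectN y L : ℝ) - halfRectN x L) / (L : ℝ) ^ 2) =
        2 * (β * (4 * |t| + 4 * |t'| + max (-U) 0)) * ((halfRectN y L : ℝ) - halfRectN x L) / (L : ℝ) ^ 2 by ring]
    exact div_le_div_of_nonneg_right h₂ hL2.le

end Finite

/-! ### §2 The limit: `p(β; n) − 2H_b(n/2)` is `βκ`-Lipschitz in the density -/

section Limit

variable {β : ℝ} (hβ : 0 ≤ β) (t t' : ℝ) {U : ℝ} (hU : 0 ≤ U)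
include hβ hU

/-- The common limit passage: the interaction free entropies converge and so do their finite-volume brackets.
[cite: Ruelle1969, §3.4] -/
private theorem interaction_sub_tendsto {x y : ℝ} (hx0 : 0 ≤ x) (hxy : x ≤ y) (hy2 : y < 2) :
    Tendsto (fun L : ℕ => (sectorPressureTT' β t t' U y L - sectorPressureTT' 0 t t' U y L) -
        (sectorPressureTT' β t t' U x L - sectorPressureTT' 0 t t' U x L)) atTop
      (𝓝 ((pressureTT' β t t' U y - 2 * Real.binEntropy (y / 2)) -
        (pressureTT' β t t' U x - 2 * Real.binEntropy (x / 2)))) ∧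
    Tendsto (fun L : ℕ => ((halfRectN y L : ℝ) - halfRectN x L) / (L : ℝ) ^ 2) atTop (𝓝 ((y - x) / 2)) := by
  have hy0 : 0 ≤ y := hx0.trans hxy
  have hx2 : x < 2 := lt_of_le_of_lt hxy hy2
  constructor
  · rw [← pressureTT'_zero t t' hU hy0 hy2, ← pressureTT'_zero t t' hU hx0 hx2]
    exact ((tendsto_sectorPressureTT' hβ t t' hU hy0 hy2).sub (tendsto_sectorPressureTT' le_rfl t t' hU hy0 hy2)).sub
      ((tendsto_sectorPressureTT' hβ t t' hU hx0 hx2).sub (tendsto_sectorPressureTT' le_rfl t t' hU hx0 hx2))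
  · have h := (tendsto_halfRectN_div_sq'' hy0).sub (tendsto_halfRectN_div_sq'' hx0)
    rw [show (y - x) / 2 = y / 2 - x / 2 by ring]
    refine h.congr fun L => ?_
    rw [sub_div]

/-- **Adding density lowers the interaction free entropy by at most `β(4|t|+4|t'|+U)` per unit density**
(`U ≥ 0`, `β ≥ 0`, `0 ≤ x ≤ y < 2`):
`−β(4|t|+4|t'|+U)(y − x) ≤ [p(β; y) − 2H_b(y/2)] − [p(β; x) − 2H_b(x/2)]`. [cite: Ruelle1969, §3.4] -/
theorem pressureTT'_sub_binEntropy_sub_ge_local {x y : ℝ} (hx0 : 0 ≤ x) (hxy : x ≤ y) (hy2 : y < 2) :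
    -(β * (4 * |t| + 4 * |t'| + U) * (y - x)) ≤
      (pressureTT' β t t' U y - 2 * Real.binEntropy (y / 2)) -
        (pressureTT' β t t' U x - 2 * Real.binEntropy (x / 2)) := by
  obtain ⟨hF, hk⟩ := interaction_sub_tendsto hβ t t' hU hx0 hxy hy2
  have hG : Tendsto (fun L : ℕ => -(2 * (β * (4 * |t| + 4 * |t'| + max U 0)) *
      (((halfRectN y L : ℝ) - halfRectN x L) / (L : ℝ) ^ 2))) atTop
      (𝓝 (-(2 * (β * (4 * |t| + 4 * |t'| + max U 0)) * ((y - x) / 2)))) := (hk.const_mul _).neg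
  have hle := le_of_tendsto_of_tendsto hG hF (eventually_atTop.2 ⟨1, fun L hL =>
    (sectorPressureTT'_interaction_sub_mem_local t t' U hβ hx0 hxy hy2 hL).1⟩)
  rw [max_eq_left hU] at hle
  have e : -(2 * (β * (4 * |t| + 4 * |t'| + U)) * ((y - x) / 2)) = -(β * (4 * |t| + 4 * |t'| + U) * (y - x)) := by
    ring
  rwa [e] at hle

/-- **Adding density raises the interaction free entropy by at most `β(4|t|+4|t'|)` per unit density**
(`U ≥ 0`, `β ≥ 0`, `0 ≤ x ≤ y < 2`):
`[p(β; y) − 2H_b(y/2)] − [p(β; x) − 2H_b(x/2)] ≤ β(4|t|+4|t'|)(y − x)`. [cite: Ruelle1969, §3.4] -/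
theorem pressureTT'_sub_binEntropy_sub_le_local {x y : ℝ} (hx0 : 0 ≤ x) (hxy : x ≤ y) (hy2 : y < 2) :
    (pressureTT' β t t' U y - 2 * Real.binEntropy (y / 2)) -
        (pressureTT' β t t' U x - 2 * Real.binEntropy (x / 2)) ≤
      β * (4 * |t| + 4 * |t'|) * (y - x) := by
  obtain ⟨hF, hk⟩ := interaction_sub_tendsto hβ t t' hU hx0 hxy hy2
  have hG : Tendsto (fun L : ℕ => 2 * (β * (4 * |t| + 4 * |t'| + max (-U) 0)) *
      (((halfRectN y L : ℝ) - halfRectN x L) / (L : ℝ) ^ 2)) atTop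
      (𝓝 (2 * (β * (4 * |t| + 4 * |t'| + max (-U) 0)) * ((y - x) / 2))) := hk.const_mul _
  have hle := le_of_tendsto_of_tendsto hF hG (eventually_atTop.2 ⟨1, fun L hL =>
    (sectorPressureTT'_interaction_sub_mem_local t t' U hβ hx0 hxy hy2 hL).2⟩)
  rw [max_eq_right (by linarith : -U ≤ 0)] at hle
  have e : 2 * (β * (4 * |t| + 4 * |t'| + 0)) * ((y - x) / 2) = β * (4 * |t| + 4 * |t'|) * (y - x) := by ring
  rwa [e] at hle

/-- **`n ↦ p(β; n) − 2H_b(n/2)` is `β(4|t|+4|t'|+U)`-Lipschitz on `[0, 2)`** (two-sided form, any order of `x, y`).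
[cite: Ruelle1969, §3.4] -/
theorem abs_pressureTT'_sub_binEntropy_sub_le_local {x y : ℝ} (hx0 : 0 ≤ x) (hx2 : x < 2) (hy0 : 0 ≤ y)
    (hy2 : y < 2) :
    |(pressureTT' β t t' U y - 2 * Real.binEntropy (y / 2)) -
        (pressureTT' β t t' U x - 2 * Real.binEntropy (x / 2))| ≤
      β * (4 * |t| + 4 * |t'| + U) * |y - x| := by
  have hκ : 0 ≤ β * (4 * |t| + 4 * |t'| + U) := by positivity
  have hweak : β * (4 * |t| + 4 * |t'|) ≤ β * (4 * |t| + 4 * |t'| + U) :=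
    mul_le_mul_of_nonneg_left (by linarith) hβ
  rcases le_total x y with hxy | hyx
  · have h1 := pressureTT'_sub_binEntropy_sub_ge_local hβ t t' hU hx0 hxy hy2
    have h2 := pressureTT'_sub_binEntropy_sub_le_local hβ t t' hU hx0 hxy hy2
    rw [abs_of_nonneg (sub_nonneg.2 hxy), abs_le]
    have h3 : β * (4 * |t| + 4 * |t'|) * (y - x) ≤ β * (4 * |t| + 4 * |t'| + U) * (y - x) :=
      mul_le_mul_of_nonneg_right hweak (sub_nonneg.2 hxy)
    constructor <;> linarith
  · have h1 := pressureTT'_sub_binEntropy_sub_ge_local hβ t t' hU hy0 hyx hx2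
    have h2 := pressureTT'_sub_binEntropy_sub_le_local hβ t t' hU hy0 hyx hx2
    rw [abs_of_nonpos (sub_nonpos.2 hyx), abs_le]
    have h3 : β * (4 * |t| + 4 * |t'|) * (x - y) ≤ β * (4 * |t| + 4 * |t'| + U) * (x - y) :=
      mul_le_mul_of_nonneg_right hweak (sub_nonneg.2 hyx)
    constructor <;> linarith

/-- **Lipschitz form**: `LipschitzOnWith (β(4|t|+4|t'|+U)) (n ↦ p(β; n) − 2H_b(n/2)) [0, 2)`. [cite: Ruelle1969, §3.4] -/
theorem lipschitzOnWith_pressureTT'_sub_binEntropy :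
    LipschitzOnWith (Real.toNNReal (β * (4 * |t| + 4 * |t'| + U)))
      (fun n => pressureTT' β t t' U n - 2 * Real.binEntropy (n / 2)) (Set.Ico 0 2) := by
  refine LipschitzOnWith.of_dist_le' fun x hx y hy => ?_
  rw [Real.dist_eq, Real.dist_eq]
  exact abs_pressureTT'_sub_binEntropy_sub_le_local hβ t t' hU hy.1 hy.2 hx.1 hx.2

end Limit

/-! ### §3 Sharp density slopes: the entropy chords against their endpoint derivatives -/

section Slopes

/-- The binary-entropy chord from below: `(y − x) log((2−y)/y) ≤ 2H_b(y/2) − 2H_b(x/2)` for `0 ≤ x < y < 2`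
(concavity of `H_b` and `H_b'(p) = log((1−p)/p)` at `p = y/2`). [cite: Israel1979, Thm. I.2.4] -/
theorem mul_log_le_two_mul_binEntropy_sub {x y : ℝ} (hx0 : 0 ≤ x) (hxy : x < y) (hy2 : y < 2) :
    (y - x) * Real.log ((2 - y) / y) ≤ 2 * Real.binEntropy (y / 2) - 2 * Real.binEntropy (x / 2) := by
  have hy0 : 0 < y := lt_of_le_of_lt hx0 hxy
  have hconc := Real.strictConcave_binEntropy.concaveOn
  have ha : x / 2 ∈ Set.Icc (0 : ℝ) 1 := ⟨by linarith, by linarith⟩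
  have hb : y / 2 ∈ Set.Icc (0 : ℝ) 1 := ⟨by linarith, by linarith⟩
  have hab : x / 2 < y / 2 := by linarith
  have hderiv := Real.hasDerivAt_binEntropy (p := y / 2) (by linarith) (by linarith)
  have hslope := hconc.le_slope_of_hasDerivAt ha hb hab hderiv
  rw [slope_def_field] at hslope
  have hpos : 0 < y / 2 - x / 2 := by linarith
  have h1 := (le_div_iff₀ hpos).1 hslope
  have hlog : Real.log (1 - y / 2) - Real.log (y / 2) = Real.log ((2 - y) / y) := by
    rw [← Real.log_div (by linarith) (by linarith)]
    congr 1
    field_simp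
  rw [hlog] at h1
  linarith

/-- The binary-entropy chord from above: `2H_b(y/2) − 2H_b(x/2) ≤ (y − x) log((2−x)/x)` for `0 < x < y ≤ 2`
(concavity of `H_b` and `H_b'(p) = log((1−p)/p)` at `p = x/2`). [cite: Israel1979, Thm. I.2.4] -/
theorem two_mul_binEntropy_sub_le_mul_log {x y : ℝ} (hx0 : 0 < x) (hxy : x < y) (hy2 : y ≤ 2) :
    2 * Real.binEntropy (y / 2) - 2 * Real.binEntropy (x / 2) ≤ (y - x) * Real.log ((2 - x) / x) := by
  have hx2 : x < 2 := lt_of_lt_of_le hxy hy2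
  have hconc := Real.strictConcave_binEntropy.concaveOn
  have ha : x / 2 ∈ Set.Icc (0 : ℝ) 1 := ⟨by linarith, by linarith⟩
  have hb : y / 2 ∈ Set.Icc (0 : ℝ) 1 := ⟨by linarith, by linarith⟩
  have hab : x / 2 < y / 2 := by linarith
  have hderiv := Real.hasDerivAt_binEntropy (p := x / 2) (by linarith) (by linarith)
  have hslope := hconc.slope_le_of_hasDerivAt ha hb hab hderiv
  rw [slope_def_field] at hslope
  have hpos : 0 < y / 2 - x / 2 := by linarith
  have h1 := (div_le_iff₀ hpos).1 hslope
  have hlog : Real.log (1 - x / 2) - Real.log (x / 2) = Real.log ((2 - x) / x) := by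
    rw [← Real.log_div (by linarith) (by linarith)]
    congr 1
    field_simp
  rw [hlog] at h1
  linarith

variable {β : ℝ} (hβ : 0 ≤ β) (t t' : ℝ) {U : ℝ} (hU : 0 ≤ U)
include hβ hU

/-- **Adding density, sharp lower bound** (`0 ≤ x ≤ y < 2`, `0 < y`):
`(y − x)(log((2−y)/y) − β(4|t|+4|t'|+U)) ≤ p(y) − p(x)` — the ideal lattice-gas entropy at the upper density minus
the top of the one-particle band. [cite: Ruelle1969, §3.4] -/
theorem density_mul_le_pressureTT'_sub_local {x y : ℝ} (hx0 : 0 ≤ x) (hxy : x ≤ y) (hy0 : 0 < y) (hy2 : y < 2) :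
    (y - x) * (Real.log ((2 - y) / y) - β * (4 * |t| + 4 * |t'| + U)) ≤
      pressureTT' β t t' U y - pressureTT' β t t' U x := by
  rcases eq_or_lt_of_le hxy with rfl | hlt
  · simp
  have h1 := pressureTT'_sub_binEntropy_sub_ge_local hβ t t' hU hx0 hxy hy2
  have h2 := mul_log_le_two_mul_binEntropy_sub hx0 hlt hy2
  nlinarith [h1, h2]

/-- **Adding density, sharp upper bound** (`0 < x ≤ y < 2`):
`p(y) − p(x) ≤ (y − x)(log((2−x)/x) + β(4|t|+4|t'|))` — the ideal lattice-gas entropy at the lower density plus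
the bandwidth bound. [cite: Ruelle1969, §3.4] -/
theorem pressureTT'_sub_le_density_mul_local {x y : ℝ} (hx0 : 0 < x) (hxy : x ≤ y) (hy2 : y < 2) :
    pressureTT' β t t' U y - pressureTT' β t t' U x ≤
      (y - x) * (Real.log ((2 - x) / x) + β * (4 * |t| + 4 * |t'|)) := by
  rcases eq_or_lt_of_le hxy with rfl | hlt
  · simp
  have h1 := pressureTT'_sub_binEntropy_sub_le_local hβ t t' hU hx0.le hxy hy2
  have h2 := two_mul_binEntropy_sub_le_mul_log hx0 hlt hy2.le
  nlinarith [h1, h2]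

/-- **The density slopes of the pressure lie in the lattice-gas band** (`0 < x < y < 2`):
`log((2−y)/y) − β(4|t|+4|t'|+U) ≤ (p(y) − p(x))/(y − x) ≤ log((2−x)/x) + β(4|t|+4|t'|)`; with `βμ = −∂p/∂n`
this is the chemical-potential band `β⁻¹log(n/(2−n)) + [−(4|t|+4|t'|), 4|t|+4|t'|+U]`. [cite: Ruelle1969, §3.4] -/
theorem pressureTT'_slope_mem_Icc_local {x y : ℝ} (hx0 : 0 < x) (hxy : x < y) (hy2 : y < 2) :
    (pressureTT' β t t' U y - pressureTT' β t t' U x) / (y - x) ∈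
      Set.Icc (Real.log ((2 - y) / y) - β * (4 * |t| + 4 * |t'| + U))
        (Real.log ((2 - x) / x) + β * (4 * |t| + 4 * |t'|)) := by
  have hpos : 0 < y - x := sub_pos.2 hxy
  constructor
  · rw [le_div_iff₀ hpos, mul_comm]
    exact density_mul_le_pressureTT'_sub_local hβ t t' hU hx0.le hxy.le (hx0.trans hxy) hy2
  · rw [div_le_iff₀ hpos, mul_comm]
    exact pressureTT'_sub_le_density_mul_local hβ t t' hU hx0 hxy.le hy2

/-- **Sharp local Lipschitz modulus of the pressure in the density.** On `[lo, hi] ⊂ (0, 2)`: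
`|p(y) − p(x)| ≤ |y − x| · (max(|log((2−lo)/lo)|, |log((2−hi)/hi)|) + β(4|t|+4|t'|+U))`. [cite: Ruelle1969, §3.4] -/
theorem abs_pressureTT'_sub_le_density_local {lo hi x y : ℝ} (hlo : 0 < lo) (hhi : hi < 2) (hx : lo ≤ x)
    (hxh : x ≤ hi) (hy : lo ≤ y) (hyh : y ≤ hi) :
    |pressureTT' β t t' U y - pressureTT' β t t' U x| ≤
      |y - x| * (max |Real.log ((2 - lo) / lo)| |Real.log ((2 - hi) / hi)| + β * (4 * |t| + 4 * |t'| + U)) := by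
  -- the entropy slopes on `[lo, hi]` lie in `[log((2−hi)/hi), log((2−lo)/lo)]`
  have hmono : ∀ {a b : ℝ}, 0 < a → a ≤ b → b < 2 → Real.log ((2 - b) / b) ≤ Real.log ((2 - a) / a) := by
    intro a b ha hab hb
    refine Real.log_le_log (div_pos (by linarith) (by linarith)) ?_
    rw [div_le_div_iff₀ (by linarith) ha]
    nlinarith
  set M := max |Real.log ((2 - lo) / lo)| |Real.log ((2 - hi) / hi)| with hM
  have hband : ∀ {a b : ℝ}, lo ≤ a → a < b → b ≤ hi →
      -M ≤ Real.log ((2 - b) / b) ∧ Real.log ((2 - a) / a) ≤ M := by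
    intro a b ha hab hb
    have h1 : Real.log ((2 - hi) / hi) ≤ Real.log ((2 - b) / b) := hmono (by linarith) hb hhi
    have h2 : Real.log ((2 - a) / a) ≤ Real.log ((2 - lo) / lo) := hmono hlo ha (by linarith)
    constructor
    · have := neg_abs_le (Real.log ((2 - hi) / hi))
      have : |Real.log ((2 - hi) / hi)| ≤ M := le_max_right _ _
      linarith
    · exact h2.trans ((le_abs_self _).trans (le_max_left _ _))
  have hκ : 0 ≤ β * (4 * |t| + 4 * |t'| + U) := by positivity
  rcases lt_trichotomy x y with hxy | rfl | hyx
  · have hs := pressureTT'_slope_mem_Icc_local hβ t t' hU (by linarith) hxy (by linarith)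
    obtain ⟨b1, b2⟩ := hband hx hxy hyh
    have hpos : 0 < y - x := sub_pos.2 hxy
    set s := (pressureTT' β t t' U y - pressureTT' β t t' U x) / (y - x) with hs_def
    have hs1 : -(M + β * (4 * |t| + 4 * |t'| + U)) ≤ s := by linarith [hs.1, b1]
    have hs2 : s ≤ M + β * (4 * |t| + 4 * |t'| + U) := by linarith [hs.2, b2, mul_nonneg hβ hU]
    have l1 := mul_le_mul_of_nonneg_right hs1 hpos.le
    have l2 := mul_le_mul_of_nonneg_right hs2 hpos.le
    have e : pressureTT' β t t' U y - pressureTT' β t t' U x = s * (y - x) := by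
      rw [hs_def, div_mul_cancel₀ _ hpos.ne']
    rw [abs_of_pos hpos, e, abs_le]
    constructor <;> linarith
  · simp
  · have hs := pressureTT'_slope_mem_Icc_local hβ t t' hU (by linarith) hyx (by linarith)
    obtain ⟨b1, b2⟩ := hband hy hyx hxh
    have hpos : 0 < x - y := sub_pos.2 hyx
    set s := (pressureTT' β t t' U x - pressureTT' β t t' U y) / (x - y) with hs_def
    have hs1 : -(M + β * (4 * |t| + 4 * |t'| + U)) ≤ s := by linarith [hs.1, b1]
    have hs2 : s ≤ M + β * (4 * |t| + 4 * |t'| + U) := by linarith [hs.2, b2, mul_nonneg hβ hU]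
    have l1 := mul_le_mul_of_nonneg_right hs1 hpos.le
    have l2 := mul_le_mul_of_nonneg_right hs2 hpos.le
    have e : pressureTT' β t t' U y - pressureTT' β t t' U x = -(s * (x - y)) := by
      rw [hs_def, div_mul_cancel₀ _ hpos.ne']; ring
    have eabs : |y - x| = x - y := by rw [abs_sub_comm]; exact abs_of_pos hpos
    rw [eabs, e, abs_le]
    constructor <;> linarith

/-- **Lipschitz on density windows, sharp constant**: on `[lo, hi] ⊂ (0, 2)` the pressure is Lipschitz with constant
`max(|log((2−lo)/lo)|, |log((2−hi)/hi)|) + β(4|t|+4|t'|+U)`. [cite: Ruelle1969, §3.4] -/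
theorem lipschitzOnWith_pressureTT'_density_local {lo hi : ℝ} (hlo : 0 < lo) (hhi : hi < 2) :
    LipschitzOnWith (Real.toNNReal (max |Real.log ((2 - lo) / lo)| |Real.log ((2 - hi) / hi)| +
        β * (4 * |t| + 4 * |t'| + U)))
      (pressureTT' β t t' U) (Set.Icc lo hi) := by
  refine LipschitzOnWith.of_dist_le' fun x hx y hy => ?_
  rw [Real.dist_eq, Real.dist_eq, mul_comm]
  exact abs_pressureTT'_sub_le_density_local hβ t t' hU hlo hhi hy.1 hy.2 hx.1 hx.2

end Slopes

end ThermodynamicLimit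

end Literature.MathematicalPhysics.QuantumLattice
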